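import Summits.QuantumFields.GaugeBoot.Rows.KZL2rpD3Emb
import Summits.QuantumFields.GaugeBoot.Certificates.KZL2HD3TabA
import Summits.QuantumFields.GaugeBoot.Certificates.KZL2rpD3TabA
import HarnessLib

/-!
# Gauge-boot: kernel check — lean3's kz-L2-H-3D entry tables are the relabelled kz-L2-rp-3D tables, blocks 14–19

Cell `pub-gaugeboot` (HOME `run/shared/lean/pub/pub-gaugeboot/`), seat lean1 (torus positivity layer for rows C15–C19, C34–C40 (+ the w1x2 / w1x3 / w2x2 windows of the same family) =
the certified kz-L2-rp-3D windows: label set, reflection lines, class/witness tables, the reduction identity; Hermitian half transported from `KZL2HD3`).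

HONEST FRAMING (page 1 of every file of this cell): certified bounds on lattice expectations at STATED coupling,
gauge group, dimension and torus size; NOT a mass gap, NOT a continuum limit, NOT a string tension, NOT large `N`.
The venture is explicitly NOT Yang–Mills-summit-bearing (barriers `FixedCouplingUltralocality`,
`PerturbativeInvisibility`).

For each block `k` of this part: `∀ i j < 20, (Sparse.ent KZL2HD3.EB k i j).map embPair = Sparse.ent KZL2rpD3.EB k i j` by
`decide +kernel` (Hermitian block dimensions ≤ 20 on both sides, equal; terms in these blocks: 18276).  Pure kernel data check
between two outputs of lean3's emitter of record (`Certificates/KZL2HD3Ent*`, landed; `Certificates/KZL2rpD3Ent*`, gb_lean_emit_reduced 0.8.6);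
nothing is claimed about lattice gauge theory in this file.
-/

noncomputable section

open Summit.QuantumFields.GaugeBoot.Certificates

namespace Summit.QuantumFields.GaugeBoot

namespace KZL2rpD3

set_option maxHeartbeats 0 in
/-- Block 14 (4594 terms, 15 × 15): lean3's `KZL2HD3` entries relabelled by `emb` = lean3's `KZL2rpD3` entries. -/
theorem entChk_14 : ∀ i j : Fin 20, (Sparse.ent KZL2HD3.EB 14 i.val j.val).map embPair = Sparse.ent KZL2rpD3.EB 14 i.val j.val := by
  decide +kernel

set_option maxHeartbeats 0 in
/-- Block 15 (1890 terms, 7 × 7): lean3's `KZL2HD3` entries relabelled by `emb` = lean3's `KZL2rpD3` entries. -/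
theorem entChk_15 : ∀ i j : Fin 20, (Sparse.ent KZL2HD3.EB 15 i.val j.val).map embPair = Sparse.ent KZL2rpD3.EB 15 i.val j.val := by
  decide +kernel

set_option maxHeartbeats 0 in
/-- Block 16 (2254 terms, 14 × 14): lean3's `KZL2HD3` entries relabelled by `emb` = lean3's `KZL2rpD3` entries. -/
theorem entChk_16 : ∀ i j : Fin 20, (Sparse.ent KZL2HD3.EB 16 i.val j.val).map embPair = Sparse.ent KZL2rpD3.EB 16 i.val j.val := by
  decide +kernel

set_option maxHeartbeats 0 in
/-- Block 17 (2664 terms, 17 × 17): lean3's `KZL2HD3` entries relabelled by `emb` = lean3's `KZL2rpD3` entries. -/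
theorem entChk_17 : ∀ i j : Fin 20, (Sparse.ent KZL2HD3.EB 17 i.val j.val).map embPair = Sparse.ent KZL2rpD3.EB 17 i.val j.val := by
  decide +kernel

set_option maxHeartbeats 0 in
/-- Block 18 (3340 terms, 19 × 19): lean3's `KZL2HD3` entries relabelled by `emb` = lean3's `KZL2rpD3` entries. -/
theorem entChk_18 : ∀ i j : Fin 20, (Sparse.ent KZL2HD3.EB 18 i.val j.val).map embPair = Sparse.ent KZL2rpD3.EB 18 i.val j.val := by
  decide +kernel

set_option maxHeartbeats 0 in
/-- Block 19 (3534 terms, 20 × 20): lean3's `KZL2HD3` entries relabelled by `emb` = lean3's `KZL2rpD3` entries. -/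
theorem entChk_19 : ∀ i j : Fin 20, (Sparse.ent KZL2HD3.EB 19 i.val j.val).map embPair = Sparse.ent KZL2rpD3.EB 19 i.val j.val := by
  decide +kernel

end KZL2rpD3

end Summit.QuantumFields.GaugeBoot

end
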